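import Summits.Ventures.HodgeRepro2.T5SU11JacobiPhaseLawEven
import Summits.Ventures.HodgeRepro2.T5SU11SphericalLegendreCfun

/-!
# The leading coefficient of the Legendre polynomials, `(2n)!/(2ⁿ n!²)`: exact degree `n`, the asymptotics
`P_n(x)/xⁿ → (2n)!/(2ⁿ n!²)`, and the `c`-function as the leading coefficient, `c(−2n) = lc(P_n)/2ⁿ`

Bonnet's recursion multiplies the leading coefficient by `(2n + 3)/(n + 2)`, so `lc(P_n) = (2n)!/(2ⁿ n!²)`
(`legLead`, `coeff_legPoly_self`), hence **`natDegree (legPoly n) = n`** and **`leadingCoeff (legPoly n) = (2n)!/(2ⁿ n!²)`**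
(`natDegree_legPoly`, `leadingCoeff_legPoly`), the shifted polynomial `Q_n = P_n(2X − 1)` has exact degree `n`
(`natDegree_legShift`), and Mathlib's `Polynomial.isEquivalent_atTop_lead` gives the asymptotics

  **`P_n(x)/xⁿ → (2n)!/(2ⁿ n!²)` as `x → ∞`**   (`tendsto_legP_div_pow`).

Comparing with `T5SU11SphericalLegendreCfun` (`c(−2n) = (2n)!/(4ⁿ n!²)`):

  **`c(−2n) = lc(P_n)/2ⁿ`**   (`cfun_neg_two_mul_eq_legLead_div`)

— the `c`-function of `SU(1,1)` at the even negative integers is the leading coefficient of the Legendre polynomial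
divided by `2ⁿ` (the factor `2ⁿ` from `cosh 2t ~ e^{2t}/2`). Nothing is claimed about (N).

Blind lane: Mathlib + the HodgeRepro2 prefix only; no sorry; axioms ⊆ {propext, Classical.choice,
Quot.sound}.
-/

namespace Summit.Ventures.HodgeRepro2.T5SU11JacobiLegendreLeading

open MeasureTheory Metric Set Filter Topology Polynomial Asymptotics
open T5SU11SphericalLegendreAll T5SU11JacobiPhaseLawEven T5SU11SphericalLegendreCfun T5SU11SphericalCfun
  T5SU11SphericalAsymptotic
open scoped Real

/-- **The leading coefficient of `P_n`**: `(2n)!/(2ⁿ n!²)`. -/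
noncomputable def legLead (n : ℕ) : ℝ := ((2 * n).factorial : ℝ) / (2 ^ n * ((n.factorial : ℝ)) ^ 2)

/-- `legLead n > 0`. -/
theorem legLead_pos (n : ℕ) : 0 < legLead n := by
  unfold legLead
  have : (0 : ℝ) < (2 * n).factorial := by exact_mod_cast Nat.factorial_pos _
  have : (0 : ℝ) < n.factorial := by exact_mod_cast Nat.factorial_pos _
  positivity

/-- **Bonnet's recursion for the leading coefficient**: `legLead (n + 2) = ((2n + 3)/(n + 2)) legLead (n + 1)`. -/
theorem legLead_succ_succ (n : ℕ) :
    legLead (n + 2) = (2 * (n : ℝ) + 3) / ((n : ℝ) + 2) * legLead (n + 1) := by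
  unfold legLead
  rw [show 2 * (n + 2) = 2 * n + 2 + 1 + 1 by ring, show 2 * (n + 1) = 2 * n + 2 by ring, Nat.factorial_succ,
    Nat.factorial_succ, show n + 2 = n + 1 + 1 by ring, Nat.factorial_succ (n + 1)]
  have h1 : (0 : ℝ) < (2 * n + 2).factorial := by exact_mod_cast Nat.factorial_pos _
  have h2 : (0 : ℝ) < (n + 1).factorial := by exact_mod_cast Nat.factorial_pos _
  push_cast
  field_simp
  ring

/-- **`coeff (legPoly n) n = legLead n`** (carried along with `n + 1`). -/
theorem coeff_legPoly_self_pair (n : ℕ) :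
    (legPoly n).coeff n = legLead n ∧ (legPoly (n + 1)).coeff (n + 1) = legLead (n + 1) := by
  induction n with
  | zero => exact ⟨by simp [legPoly, legLead], by simp [legPoly, legLead]⟩
  | succ n ih =>
    refine ⟨ih.2, ?_⟩
    rw [legPoly_succ_succ, coeff_sub, mul_assoc, coeff_C_mul, coeff_X_mul, ih.2, coeff_C_mul,
      coeff_eq_zero_of_natDegree_lt (lt_of_le_of_lt (natDegree_legPoly_le n) (by omega)), mul_zero, sub_zero,
      legLead_succ_succ]

/-- **`coeff (legPoly n) n = legLead n`.** -/
theorem coeff_legPoly_self (n : ℕ) : (legPoly n).coeff n = legLead n := (coeff_legPoly_self_pair n).1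

/-- **`natDegree (legPoly n) = n`.** -/
theorem natDegree_legPoly (n : ℕ) : (legPoly n).natDegree = n :=
  natDegree_eq_of_le_of_coeff_ne_zero (natDegree_legPoly_le n) (by rw [coeff_legPoly_self]; exact (legLead_pos n).ne')

/-- **`leadingCoeff (legPoly n) = legLead n`.** -/
theorem leadingCoeff_legPoly (n : ℕ) : (legPoly n).leadingCoeff = legLead n := by
  rw [leadingCoeff, natDegree_legPoly, coeff_legPoly_self]

/-- **`P_n(x)/xⁿ → (2n)!/(2ⁿ n!²)` as `x → ∞`.** -/
theorem tendsto_legP_div_pow (n : ℕ) :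
    Tendsto (fun x : ℝ => legP n x / x ^ n) atTop (𝓝 (legLead n)) := by
  have h := (isEquivalent_atTop_lead (legPoly n)).div (IsEquivalent.refl (u := fun x : ℝ => x ^ n))
  rw [natDegree_legPoly, leadingCoeff_legPoly] at h
  have e : (fun x : ℝ => legP n x / x ^ n) = fun x : ℝ => (legPoly n).eval x / x ^ n := by
    funext x
    rw [legP_eq_eval]
  rw [e]
  refine h.tendsto_nhds_iff.mpr ?_
  refine tendsto_const_nhds.congr' ?_
  filter_upwards [eventually_gt_atTop (0 : ℝ)] with x hx
  simp only [Pi.div_apply]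
  field_simp

/-- **`c(−2n) = lc(P_n)/2ⁿ`**: the `c`-function at the even negative integers is the leading coefficient of the
Legendre polynomial over `2ⁿ`. -/
theorem cfun_neg_two_mul_eq_legLead_div (n : ℕ) : cfun (-(2 * (n : ℝ))) = legLead n / 2 ^ n := by
  rw [cfun_neg_two_mul, legLead]
  have : (0 : ℝ) < n.factorial := by exact_mod_cast Nat.factorial_pos _
  have h4 : (4 : ℝ) ^ n = 2 ^ n * 2 ^ n := by rw [← mul_pow]; norm_num
  rw [h4]
  field_simp

/-- **`natDegree (legShift n) = n`** (`Q_n = P_n ∘ (2X − 1)` has the same degree). -/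
theorem natDegree_legShift (n : ℕ) : (legShift n).natDegree = n := by
  refine le_antisymm (natDegree_legShift_le n) ?_
  unfold legShift
  rw [natDegree_comp, natDegree_legPoly, natDegree_sub_C, natDegree_C_mul (by norm_num), natDegree_X, mul_one]

end Summit.Ventures.HodgeRepro2.T5SU11JacobiLegendreLeading
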